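import Literature.Geometry.Lorentzian.KerrDeSitterRadialTSFormThreeHalves
import HarnessLib

/-!
# Half-integer spin `|s| = 3/2` on the real axis, IV: the Teukolsky–Starobinsky ladder — the
# spin-`3/2` radial equation as a first-order system, and the form in the ladder basis

HONEST LABEL. Pure algebra plus one pointwise derivative computation; no horizon limit and no
statement about radial solutions vanishing. This file isolates the structure that makes the
remaining endpoint evaluation (the right limit at `r₊` on the singular ingoing branch) a ONE-jet
computation: with `a := (3/2)Δ′ + iK̃` and `c := (λ̃ − Δ″/6) − 2iK̃′` the first rung
`P₁ := ΔR′ + aR` of Wu–Yan's `𝒟†`-ladder satisfies, along every solution of the spin-`3/2` radial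
equation (generic even quartic `Δ`, even quadratic `K̃`, real data),
  `P₁′ = (iK̃/Δ)·P₁ + c·R`                                   (`hasDerivAt_tsqLadder`)
— literally the first-order system `P′ = (iΞK/Δ)P + λR` of the spin-`1/2` case
(`hasDerivAt_tsPartner_half`) with the constant `λ` replaced by the quadratic `c(r)` — and the
conserved form of files II/III is, in the basis `(R, P₁)`,
  `W = Δ²n₁₁|R|² + 2Re(Δ·n₁₂·R·conj P₁) + p₂₂|P₁|²`            (`tsqForm_eq_ladder`)
with the SMALL polynomials `n₁₁ = |c|² − 4d₄Δ`, `Re n₁₂ = −p₂₂′/2`,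
`Im n₁₂ = −2 Re c·K̃ + (Im c)Δ′/2 + 4k₂Δ` (`tsq_ladder_M11/M12re/M12im`: `p₁₁ − 2Re(p₁₂ā) + |a|²p₂₂ = Δ²n₁₁`,
`p₁₂ − a·p₂₂ = Δ·n₁₂`). On Kerr–de Sitter (`hasDerivAt_tsLadderThreeHalves`) this is the statement that
`(R, ΔR′ + ((3/2)Δ_r′ + iΞK)R)` solves a first-order system with coefficient
`c = λ + (1 − α)/3 − Δ_r″/6 − 4iΞωr` at real `ω`, `λ`. Definitions with bodies + theorems, NO named
facts.

Sources: [WuYan2004] Appendix A (A3)–(A5) (the operators `𝒟_n† = ∂_r + iΞK/Δ_r + nΔ_r′/Δ_r`; here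
`Δ𝒟†_{3/2}`); [Costa2019] Proposition 2.21 (the half-integer energy identity whose current this form
is); [SuzukiTakasugiUmetsu1998] (3.7) (the radial equation).
-/

noncomputable section

open Complex Set Filter Topology

open scoped ComplexConjugate

namespace Literature.Geometry.Lorentzian.KerrDeSitter

/-! ### The ladder coefficient `c` and the form in the ladder basis -/

/-- `Re c = λ̃ − Δ″/6 = λ̃ − d₂/3 − 2d₄r²`, real part of the zeroth-order coefficient of the
spin-`3/2` Teukolsky–Starobinsky ladder `P₁′ = (iK̃/Δ)P₁ + cR`. [cite: WuYan2004, Appendix A, (A5)] -/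
def tsqCre (d₂ d₄ el r : ℝ) : ℝ := el - d₂ / 3 - 2 * d₄ * r ^ 2

/-- `Im c = −2K̃′ = −4k₂r`, imaginary part of the ladder coefficient. [cite: WuYan2004, Appendix A, (A5)] -/
def tsqCim (k₂ r : ℝ) : ℝ := -(4 * k₂ * r)

/-- `n₁₁ = |c|² − 4d₄Δ`: the `|R|²`-coefficient of the spin-`3/2` form in the ladder basis is `Δ²n₁₁`.
[cite: Costa2019, Proposition 2.21] -/
def tsqN11 (d₀ d₁ d₂ d₄ k₂ el r : ℝ) : ℝ :=
  tsqCre d₂ d₄ el r ^ 2 + tsqCim k₂ r ^ 2 - 4 * d₄ * tsqDelta d₀ d₁ d₂ d₄ r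

/-- `Re n₁₂ = −p₂₂′/2`: real part of the `R·conj P₁`-coefficient `Δ·n₁₂` of the form in the ladder
basis. [cite: Costa2019, Proposition 2.21] -/
def tsqN12re (d₀ d₁ d₂ d₄ k₀ k₂ el r : ℝ) : ℝ := -tsqP22d d₀ d₁ d₂ d₄ k₀ k₂ el r / 2

/-- `Im n₁₂ = −2 Re c·K̃ + (Im c)Δ′/2 + 4k₂Δ`: imaginary part of the `R·conj P₁`-coefficient `Δ·n₁₂`.
[cite: Costa2019, Proposition 2.21] -/
def tsqN12im (d₀ d₁ d₂ d₄ k₀ k₂ el r : ℝ) : ℝ :=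
  -2 * tsqCre d₂ d₄ el r * tsqK k₀ k₂ r + tsqCim k₂ r * tsqDeltaD d₁ d₂ d₄ r / 2 +
    4 * k₂ * tsqDelta d₀ d₁ d₂ d₄ r

/-- **(M11)** `p₁₁ − 2Re(p₁₂·conj a) + |a|²·p₂₂ = Δ²·n₁₁`, `a = (3/2)Δ′ + iK̃`: the `|R|²`-coefficient
of the form in the basis `(R, P₁)` is divisible by `Δ²`, with the eight-term quotient
`n₁₁ = |c|² − 4d₄Δ`. [cite: Costa2019, Proposition 2.21] -/
theorem tsq_ladder_M11 (d₀ d₁ d₂ d₄ k₀ k₂ el r : ℝ) :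
    tsqP11 d₀ d₁ d₂ d₄ k₀ k₂ el r -
        2 * (tsqP12re d₀ d₁ d₂ d₄ k₀ k₂ el r * (3 / 2 * tsqDeltaD d₁ d₂ d₄ r) +
          tsqP12im d₀ d₁ d₂ d₄ k₀ k₂ el r * tsqK k₀ k₂ r) +
        ((3 / 2 * tsqDeltaD d₁ d₂ d₄ r) ^ 2 + tsqK k₀ k₂ r ^ 2) * tsqP22 d₀ d₁ d₂ d₄ k₀ k₂ el r =
      tsqDelta d₀ d₁ d₂ d₄ r ^ 2 * tsqN11 d₀ d₁ d₂ d₄ k₂ el r := by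
  unfold tsqP11 tsqP12re tsqP12im tsqDeltaD tsqK tsqP22 tsqDelta tsqN11 tsqCre tsqCim tsqDelta
  ring

/-- **(M12), real part** `Re p₁₂ − (3/2)Δ′·p₂₂ = Δ·Re n₁₂ = −Δp₂₂′/2` (this is (P3)).
[cite: Costa2019, Proposition 2.21] -/
theorem tsq_ladder_M12re (d₀ d₁ d₂ d₄ k₀ k₂ el r : ℝ) :
    tsqP12re d₀ d₁ d₂ d₄ k₀ k₂ el r - 3 / 2 * tsqDeltaD d₁ d₂ d₄ r * tsqP22 d₀ d₁ d₂ d₄ k₀ k₂ el r =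
      tsqDelta d₀ d₁ d₂ d₄ r * tsqN12re d₀ d₁ d₂ d₄ k₀ k₂ el r := by
  unfold tsqP12re tsqDeltaD tsqP22 tsqDelta tsqN12re tsqP22d
  ring

/-- **(M12), imaginary part** `Im p₁₂ − K̃·p₂₂ = Δ·Im n₁₂`. [cite: Costa2019, Proposition 2.21] -/
theorem tsq_ladder_M12im (d₀ d₁ d₂ d₄ k₀ k₂ el r : ℝ) :
    tsqP12im d₀ d₁ d₂ d₄ k₀ k₂ el r - tsqK k₀ k₂ r * tsqP22 d₀ d₁ d₂ d₄ k₀ k₂ el r =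
      tsqDelta d₀ d₁ d₂ d₄ r * tsqN12im d₀ d₁ d₂ d₄ k₀ k₂ el r := by
  unfold tsqP12im tsqK tsqP22 tsqDelta tsqN12im tsqCre tsqCim tsqK tsqDeltaD tsqDelta
  ring

/-- **The spin-`3/2` form in the ladder basis.** With `P₁ := Δv + a·u`, `a = (3/2)Δ′ + iK̃`,
`W(r; u, v) = Δ²n₁₁|u|² + 2Re(Δ·n₁₂·u·conj P₁) + p₂₂|P₁|²` (an identity for all `u, v ∈ ℂ`).
[cite: Costa2019, Proposition 2.21] -/
theorem tsqForm_eq_ladder (d₀ d₁ d₂ d₄ k₀ k₂ el r : ℝ) (u v : ℂ) :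
    tsqForm d₀ d₁ d₂ d₄ k₀ k₂ el r u v =
      tsqDelta d₀ d₁ d₂ d₄ r ^ 2 * tsqN11 d₀ d₁ d₂ d₄ k₂ el r * normSq u +
        2 * ((tsqDelta d₀ d₁ d₂ d₄ r : ℂ) *
          ((tsqN12re d₀ d₁ d₂ d₄ k₀ k₂ el r : ℂ) + I * (tsqN12im d₀ d₁ d₂ d₄ k₀ k₂ el r : ℂ)) * u *
          conj ((tsqDelta d₀ d₁ d₂ d₄ r : ℂ) * v +
            (((3 / 2 * tsqDeltaD d₁ d₂ d₄ r : ℝ) : ℂ) + I * (tsqK k₀ k₂ r : ℂ)) * u)).re +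
        tsqP22 d₀ d₁ d₂ d₄ k₀ k₂ el r *
          normSq ((tsqDelta d₀ d₁ d₂ d₄ r : ℂ) * v +
            (((3 / 2 * tsqDeltaD d₁ d₂ d₄ r : ℝ) : ℂ) + I * (tsqK k₀ k₂ r : ℂ)) * u) := by
  have e11 := tsq_ladder_M11 d₀ d₁ d₂ d₄ k₀ k₂ el r
  have e12r := tsq_ladder_M12re d₀ d₁ d₂ d₄ k₀ k₂ el r
  have e12i := tsq_ladder_M12im d₀ d₁ d₂ d₄ k₀ k₂ el r
  simp only [tsqForm, normSq_apply, mul_re, mul_im, add_re, add_im, conj_re, conj_im, ofReal_re,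
    ofReal_im, I_re, I_im]
  linear_combination (u.re * u.re + u.im * u.im) * e11 +
    (2 * (3 / 2 * tsqDeltaD d₁ d₂ d₄ r) * (u.re * u.re + u.im * u.im) +
      2 * tsqDelta d₀ d₁ d₂ d₄ r * (u.re * v.re + u.im * v.im)) * e12r +
    (2 * tsqK k₀ k₂ r * (u.re * u.re + u.im * u.im) -
      2 * tsqDelta d₀ d₁ d₂ d₄ r * (u.im * v.re - u.re * v.im)) * e12i

/-! ### The ladder: the spin-`3/2` equation as a first-order system -/

/-- `Δ″` is the derivative of `Δ′`. [cite: Hatsuda2020, (2.13)] -/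
theorem hasDerivAt_tsqDeltaD (d₁ d₂ d₄ r : ℝ) :
    HasDerivAt (fun x => tsqDeltaD d₁ d₂ d₄ x) (tsqDeltaDD d₂ d₄ r) r := by
  have h := ((hasDerivAt_const r d₁).fun_add ((hasDerivAt_id' r).const_mul (2 * d₂))).fun_add
    ((hasDerivAt_pow 3 r).const_mul (4 * d₄))
  have hf : (fun x => d₁ + 2 * d₂ * x + 4 * d₄ * x ^ 3) = fun x => tsqDeltaD d₁ d₂ d₄ x := by
    funext x; simp only [tsqDeltaD]
  rw [hf] at h
  refine h.congr_deriv ?_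
  simp only [tsqDeltaDD, Nat.cast_ofNat]
  ring

/-- `K̃′ = 2k₂r`. [cite: Hatsuda2020, (2.14)] -/
theorem hasDerivAt_tsqK (k₀ k₂ r : ℝ) :
    HasDerivAt (fun x => tsqK k₀ k₂ x) (2 * k₂ * r) r := by
  have h := (hasDerivAt_const r k₀).fun_add ((hasDerivAt_pow 2 r).const_mul k₂)
  have hf : (fun x => k₀ + k₂ * x ^ 2) = fun x => tsqK k₀ k₂ x := by
    funext x; simp only [tsqK]
  rw [hf] at h
  refine h.congr_deriv ?_
  simp only [Nat.cast_ofNat]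
  ring

/-- **The Teukolsky–Starobinsky ladder at spin `3/2` (generic even quartic).** If `Δ(r) ≠ 0`, `R` is
twice differentiable at `r` and `Δ²R″ + (5/2)ΔΔ′R′ + N_V R = 0` there (`N_V = Re N_V + i Im N_V`,
real data), then the first rung `P₁ := ΔR′ + ((3/2)Δ′ + iK̃)R` (Wu–Yan's `Δ𝒟†_{3/2}R`) satisfies
`P₁′ = (iK̃/Δ)·P₁ + c·R` at `r`, `c = (λ̃ − Δ″/6) − 2iK̃′` (`tsqCre`, `tsqCim`). The identity behind
it is `Δ·a′ − N_V − iK̃·a = Δ·c` for `a = (3/2)Δ′ + iK̃`. This is the spin-`3/2` analogue of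
`hasDerivAt_tsPartner_half` (where `c` is the constant `λ`). [cite: WuYan2004, Appendix A, (A5)] -/
theorem hasDerivAt_tsqLadder {d₀ d₁ d₂ d₄ k₀ k₂ el : ℝ} {R R' R'' : ℝ → ℂ} {r : ℝ}
    (hΔ : tsqDelta d₀ d₁ d₂ d₄ r ≠ 0) (h1 : HasDerivAt R (R' r) r) (h2 : HasDerivAt R' (R'' r) r)
    (heq : (tsqDelta d₀ d₁ d₂ d₄ r : ℂ) ^ 2 * R'' r +
      5 / 2 * (tsqDelta d₀ d₁ d₂ d₄ r : ℂ) * (tsqDeltaD d₁ d₂ d₄ r : ℂ) * R' r +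
        ((tsqNVre d₀ d₁ d₂ d₄ k₀ k₂ el r : ℂ) + I * (tsqNVim d₀ d₁ d₂ d₄ k₀ k₂ r : ℂ)) * R r =
          0) :
    HasDerivAt (fun y => (tsqDelta d₀ d₁ d₂ d₄ y : ℂ) * R' y +
        (((3 / 2 * tsqDeltaD d₁ d₂ d₄ y : ℝ) : ℂ) + I * (tsqK k₀ k₂ y : ℂ)) * R y)
      (I * (tsqK k₀ k₂ r : ℂ) / (tsqDelta d₀ d₁ d₂ d₄ r : ℂ) *
          ((tsqDelta d₀ d₁ d₂ d₄ r : ℂ) * R' r +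
            (((3 / 2 * tsqDeltaD d₁ d₂ d₄ r : ℝ) : ℂ) + I * (tsqK k₀ k₂ r : ℂ)) * R r) +
        ((tsqCre d₂ d₄ el r : ℂ) + I * (tsqCim k₂ r : ℂ)) * R r) r := by
  have hΔc : (tsqDelta d₀ d₁ d₂ d₄ r : ℂ) ≠ 0 := by exact_mod_cast hΔ
  have hDd : HasDerivAt (fun y => (tsqDelta d₀ d₁ d₂ d₄ y : ℂ)) ((tsqDeltaD d₁ d₂ d₄ r : ℝ) : ℂ) r :=
    (hasDerivAt_tsqDelta d₀ d₁ d₂ d₄ r).ofReal_comp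
  have hKd : HasDerivAt (fun y => (tsqK k₀ k₂ y : ℂ)) ((2 * k₂ * r : ℝ) : ℂ) r :=
    (hasDerivAt_tsqK k₀ k₂ r).ofReal_comp
  have hD1d' : HasDerivAt (fun y => ((3 / 2 * tsqDeltaD d₁ d₂ d₄ y : ℝ) : ℂ))
      ((3 / 2 * tsqDeltaDD d₂ d₄ r : ℝ) : ℂ) r :=
    ((hasDerivAt_tsqDeltaD d₁ d₂ d₄ r).const_mul (3 / 2)).ofReal_comp
  have hprod := (hDd.fun_mul h2).fun_add ((hD1d'.fun_add (hKd.const_mul I)).fun_mul h1)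
  refine hprod.congr_deriv ?_
  have hR'' : R'' r = (-(5 / 2 * (tsqDelta d₀ d₁ d₂ d₄ r : ℂ) * (tsqDeltaD d₁ d₂ d₄ r : ℂ) * R' r) -
      ((tsqNVre d₀ d₁ d₂ d₄ k₀ k₂ el r : ℂ) + I * (tsqNVim d₀ d₁ d₂ d₄ k₀ k₂ r : ℂ)) * R r) /
        (tsqDelta d₀ d₁ d₂ d₄ r : ℂ) ^ 2 := by
    rw [eq_div_iff (pow_ne_zero 2 hΔc)]
    linear_combination heq
  rw [hR'']
  unfold tsqNVre tsqNVim tsqCre tsqCim tsqDeltaDD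
  push_cast
  field_simp
  linear_combination (-6 * (tsqK k₀ k₂ r : ℂ) ^ 2 * R r) * I_sq

/-! ### Kerr–de Sitter -/

/-- **The Teukolsky–Starobinsky ladder of the Kerr–de Sitter spin-`3/2` radial equation at real
frequency.** If `Im ω = Im λ = 0`, `Δ_r(r) ≠ 0` and `R` solves `Δ_r R″ + (5/2)Δ_r′R′ + V_{3/2}R = 0`
at `r` (pointwise, with `HasDerivAt` witnesses), then `P₁ := Δ_r R′ + ((3/2)Δ_r′ + iΞK)R` satisfies
`P₁′ = (iΞK/Δ_r)P₁ + c·R` with `c = λ + (1 − α)/3 − Δ_r″/6 − 4iΞω r`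
(`Δ_r″ = 2(1 − α) − 4Λr²`; the generic coefficients are instantiated as in
`radialPotential_threeHalves_mul_delta`). [cite: WuYan2004, Appendix A, (A5)] -/
theorem hasDerivAt_tsLadderThreeHalves {M a Λ : ℝ} {ω : ℂ} {m : ℝ} {lam : ℂ} {R R' R'' : ℝ → ℂ}
    {r : ℝ} (hω : ω.im = 0) (hlam : lam.im = 0) (hΔ : delta M a Λ r ≠ 0)
    (h1 : HasDerivAt R (R' r) r) (h2 : HasDerivAt R' (R'' r) r)
    (heq : (delta M a Λ r : ℂ) * R'' r + ((3 / 2 + 1 : ℝ) : ℂ) * (deltaDeriv M a Λ r : ℂ) * R' r +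
      radialPotential M a Λ (3 / 2) ω m lam r * R r = 0) :
    HasDerivAt (fun y => (tsqDelta (a ^ 2) (-(2 * M)) (1 - Λ / 3 * a ^ 2) (-(Λ / 3)) y : ℂ) * R' y +
        (((3 / 2 * tsqDeltaD (-(2 * M)) (1 - Λ / 3 * a ^ 2) (-(Λ / 3)) y : ℝ) : ℂ) +
          I * (tsqK (kdsK0 a Λ ω m) (kdsK2 a Λ ω) y : ℂ)) * R y)
      (I * (tsqK (kdsK0 a Λ ω m) (kdsK2 a Λ ω) r : ℂ) /
            (tsqDelta (a ^ 2) (-(2 * M)) (1 - Λ / 3 * a ^ 2) (-(Λ / 3)) r : ℂ) *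
          ((tsqDelta (a ^ 2) (-(2 * M)) (1 - Λ / 3 * a ^ 2) (-(Λ / 3)) r : ℂ) * R' r +
            (((3 / 2 * tsqDeltaD (-(2 * M)) (1 - Λ / 3 * a ^ 2) (-(Λ / 3)) r : ℝ) : ℂ) +
              I * (tsqK (kdsK0 a Λ ω m) (kdsK2 a Λ ω) r : ℂ)) * R r) +
        ((tsqCre (1 - Λ / 3 * a ^ 2) (-(Λ / 3)) (kdsEl a Λ lam) r : ℂ) +
          I * (tsqCim (kdsK2 a Λ ω) r : ℂ)) * R r) r := by
  have hΔ' : tsqDelta (a ^ 2) (-(2 * M)) (1 - Λ / 3 * a ^ 2) (-(Λ / 3)) r ≠ 0 := by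
    rwa [← delta_eq_tsqDelta]
  have hV := radialPotential_threeHalves_mul_delta M a Λ hω m hlam hΔ
  have heq2 : (tsqDelta (a ^ 2) (-(2 * M)) (1 - Λ / 3 * a ^ 2) (-(Λ / 3)) r : ℂ) ^ 2 * R'' r +
      5 / 2 * (tsqDelta (a ^ 2) (-(2 * M)) (1 - Λ / 3 * a ^ 2) (-(Λ / 3)) r : ℂ) *
          (tsqDeltaD (-(2 * M)) (1 - Λ / 3 * a ^ 2) (-(Λ / 3)) r : ℂ) * R' r +
        ((tsqNVre (a ^ 2) (-(2 * M)) (1 - Λ / 3 * a ^ 2) (-(Λ / 3)) (kdsK0 a Λ ω m) (kdsK2 a Λ ω)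
              (kdsEl a Λ lam) r : ℂ) +
          I * (tsqNVim (a ^ 2) (-(2 * M)) (1 - Λ / 3 * a ^ 2) (-(Λ / 3)) (kdsK0 a Λ ω m)
              (kdsK2 a Λ ω) r : ℂ)) * R r = 0 := by
    rw [← delta_eq_tsqDelta, ← deltaDeriv_eq_tsqDeltaD, ← hV]
    have h := congrArg (fun z => z * (delta M a Λ r : ℂ)) heq
    simp only [zero_mul] at h
    push_cast at h
    linear_combination h
  exact hasDerivAt_tsqLadder hΔ' h1 h2 heq2

end Literature.Geometry.Lorentzian.KerrDeSitter

end
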